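import Literature.MathematicalPhysics.QuantumFieldTheory.OSDensityNearExplicit
import Literature.MathematicalPhysics.QuantumFieldTheory.OSWindowConstants
import Literature.MathematicalPhysics.QuantumFieldTheory.OSDescendantBounds
import HarnessLib

/-!
# The explicit pointwise bound of the Schwinger density (towards OS II Thm. 4.1 (4.5))

Topic `Literature/MathematicalPhysics/QuantumFieldTheory`; support file for the temperedness
estimate (4.5) of Osterwalder–Schrader II, Thm. 4.1. With the explicit skeleton data of
`OSQuantSkeletonData`, the base index of `OSBaseIndex`, the local density of
`OSDensityNearExplicit`, the frame bounds of `OSFrameBounds` and the descendant bounds of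
`OSDescendantBounds`, the value of the local holomorphic density at a time-ordered configuration
`x` is bounded by an **explicit closed-form function `qsF x` of `x`** (through `‖x‖` and the minimal
time gap `minGap x` only, besides the E0'/temperedness data of the Schwinger family):

* the pieces: bump radius `qsR0`, logarithmic radius `qsLam` (`= logRadius` at the parameter
  point), window `qsB = (1 + qsLam)⁻¹`, dual bound `qsDd`, multiplier constant `qsD`, Jacobian
  bounds `qsCLow ≤ c ≤ qsCUp`, scalar bound `qsA0B`, profile bound `qsPB`, and the `a`-independent
  factor `qsA = qsE · qsU · qsTT` of `regCW` (`regCW_qs_eq`);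
* `schwinger_density_centre_le` — `‖S(x)‖ ≤ qsF x := qsCUp x · descBound k d (qsD x) (qsA x) (qsA0B x) (qsPB x) p (qsR x)`.

The polynomial estimate of `qsF` in `‖x‖` and `(minGap x)⁻¹` is carried out separately.

## References

* K. Osterwalder, R. Schrader, *Axioms for Euclidean Green's functions II*, Comm. Math. Phys.
  42 (1975) 281–305, Thm. 4.1 (4.5), Ch. V.1, Ch. VI.1. [OsterwalderSchraderCMP1975]
-/

noncomputable section

open MeasureTheory Set Filter Module Metric Real
open _root_.Topology
open scoped InnerProductSpace RealInnerProductSpace SchwartzMap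

namespace Literature.MathematicalPhysics.QuantumFieldTheory

open Literature.MathematicalPhysics.QuantumLattice (SchwingerFamily IsPositiveTimeMulti schwartzNorm)
open Literature.MathematicalPhysics.QuantumLattice.SchwingerFamily
open Literature.MathematicalPhysics.QuantumLattice.SchwingerFamily.OSSpace
open Literature.Analysis.FunctionSpaces.SchwartzAverage
open Literature.Analysis.Distribution
open Literature.Analysis.Complex
open OSFrames

variable {d : ℕ} [NeZero d] {k : ℕ}

/-! ### The bump radius -/

/-- **The bump radius** `r₀ = min 1 (g/4)`. [folklore] -/
def qsR0 (x : Fin (k + 2) → EuclideanSpace ℝ (Fin d)) : ℝ := min 1 (qsG x / 4)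

/-- `r₀ > 0`. [folklore] -/
theorem qsR0_pos {x : Fin (k + 2) → EuclideanSpace ℝ (Fin d)} (hx : x ∈ orderedRegion k d) : 0 < qsR0 x :=
  lt_min one_pos (by have := qsG_pos hx; positivity)

/-- `r₀ ≤ 1`. [folklore] -/
theorem qsR0_le_one (x : Fin (k + 2) → EuclideanSpace ℝ (Fin d)) : qsR0 x ≤ 1 := min_le_left _ _

/-- `2 r₀ < g`. [folklore] -/
theorem two_mul_qsR0_lt {x : Fin (k + 2) → EuclideanSpace ℝ (Fin d)} (hx : x ∈ orderedRegion k d) : 2 * qsR0 x < qsG x := by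
  have h1 : qsR0 x ≤ qsG x / 4 := min_le_right _ _
  linarith [qsG_pos hx]

/-! ### The logarithmic radius and the window -/

/-- **The logarithmic radius** `Λ = |log(t − r)| + |log(t + r)|`. [folklore] -/
def qsLam (x : Fin (k + 2) → EuclideanSpace ℝ (Fin d)) : ℝ := |Real.log (qsT x - qsR x)| + |Real.log (qsT x + qsR x)|

/-- `Λ ≥ 0`. [folklore] -/
theorem qsLam_nonneg (x : Fin (k + 2) → EuclideanSpace ℝ (Fin d)) : 0 ≤ qsLam x := by unfold qsLam; positivity

/-- **The logarithmic radius of the parameter point is `Λ`.** [folklore] -/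
theorem logRadius_tailR_qsU0 (x : Fin (k + 2) → EuclideanSpace ℝ (Fin d)) (hli : LinearIndependent ℝ (qsFrame x)) :
    logRadius (tailR (qsU0 x hli)) (qsR x) = qsLam x := by
  unfold logRadius qsLam
  have h1 : (fun j : Fin (slotK k d + 1) => tailR (qsU0 x hli) j) = fun _ => qsT x := funext (tailR_qsU0 x hli)
  simp only [h1, Finset.inf'_const, Finset.sup'_const]

/-- **The window** `b = (1 + Λ)⁻¹`. [folklore] -/
def qsB (x : Fin (k + 2) → EuclideanSpace ℝ (Fin d)) : ℝ := (1 + qsLam x)⁻¹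

/-- `b > 0`. [folklore] -/
theorem qsB_pos (x : Fin (k + 2) → EuclideanSpace ℝ (Fin d)) : 0 < qsB x := by
  unfold qsB; have := qsLam_nonneg x; positivity

/-- `b ≤ 1`. [folklore] -/
theorem qsB_le_one (x : Fin (k + 2) → EuclideanSpace ℝ (Fin d)) : qsB x ≤ 1 := by
  unfold qsB; exact inv_le_one_of_one_le₀ (by linarith [qsLam_nonneg x])

/-! ### The dual bound and the multiplier constant -/

/-- **The dual bound** `2 (1 + √d) / ε`. [folklore] -/
def qsDd (x : Fin (k + 2) → EuclideanSpace ℝ (Fin d)) : ℝ := 2 * (1 + Real.sqrt d) / qsEps x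

/-- `qsDd ≥ 0` on the ordered region. [folklore] -/
theorem qsDd_nonneg {x : Fin (k + 2) → EuclideanSpace ℝ (Fin d)} (hx : x ∈ orderedRegion k d) : 0 ≤ qsDd x := by
  unfold qsDd; have := qsEps_pos hx; positivity

/-- **The dual directions of the frame are bounded by the dual bound.** [folklore] -/
theorem norm_dualDir_qsFrame_le {x : Fin (k + 2) → EuclideanSpace ℝ (Fin d)} (hx : x ∈ orderedRegion k d) (ν : Fin d) :
    ‖dualDir (qsFrame x) (linearIndependent_qsFrame hx) ν‖ ≤ qsDd x := by
  have hε0 := qsEps_pos hx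
  have hε' : |qsEps x| < 1 := (abs_qsEps_lt hx).trans (by norm_num)
  have h := dualDir_stdFrame (d := d) (ε := qsEps x) hε0.ne' (by linarith) hε' (linearIndependent_qsFrame hx) ν
  change ‖dualDir (stdFrame (qsEps x)) (linearIndependent_qsFrame hx) ν‖ ≤ qsDd x
  rw [h]
  exact norm_stdDual_le' hε0 (by linarith [qsEps_lt hx]) ν

/-- **The multiplier constant** `D = max 1 (2^M · qsDd · (r₀ + 1))`. [folklore] -/
def qsD (M : ℕ) (x : Fin (k + 2) → EuclideanSpace ℝ (Fin d)) : ℝ := max 1 (2 ^ M * (qsDd x * (qsR0 x + 1)))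

/-- `1 ≤ D`. [folklore] -/
theorem one_le_qsD (M : ℕ) (x : Fin (k + 2) → EuclideanSpace ℝ (Fin d)) : 1 ≤ qsD M x := le_max_left _ _

/-- **The multiplier bound**: `|⟪·, dualDir ν⟫ φ|_M ≤ D |φ|_M` for `φ` supported in `B̄(0, r₀)`. [folklore] -/
theorem qsD_spec {x : Fin (k + 2) → EuclideanSpace ℝ (Fin d)} (hx : x ∈ orderedRegion k d) (M : ℕ) (ν : Fin d)
    (φ : 𝓢(EuclideanSpace ℝ (Fin d), ℂ)) (hφ : tsupport (φ : EuclideanSpace ℝ (Fin d) → ℂ) ⊆ Metric.closedBall 0 (qsR0 x)) :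
    schwartzNorm M (coordMul (dualDir (qsFrame x) (linearIndependent_qsFrame hx) ν) φ) ≤ qsD M x * schwartzNorm M φ := by
  refine (schwartzNorm_coordMul_le _ (qsR0_pos hx).le hφ M).trans ?_
  refine mul_le_mul_of_nonneg_right ?_ (QuantumLattice.schwartzNorm_nonneg _ _)
  refine le_trans ?_ (le_max_right _ _)
  have h1 := norm_dualDir_qsFrame_le hx ν
  have h2 : 0 ≤ qsR0 x + 1 := by linarith [qsR0_pos hx]
  gcongr

/-! ### The Jacobian constant -/

/-- **The upper Jacobian bound** `(2 √((k+2) d) qsDd)^{(k+2)d} · jacobianRatio`. [folklore] -/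
def qsCUp (x : Fin (k + 2) → EuclideanSpace ℝ (Fin d)) : ℝ :=
  (2 * Real.sqrt ((k + 2 : ℝ) * d) * qsDd x) ^ Fintype.card (Fin (k + 2) × Fin d) * jacobianRatio k d

/-- **The lower Jacobian bound** `((k+2) d)^{-(k+2)d} · jacobianRatio` (independent of `x`). [folklore] -/
def qsCLow (k d : ℕ) : ℝ := (((k + 2 : ℝ) * d)⁻¹) ^ Fintype.card (Fin (k + 2) × Fin d) * jacobianRatio k d

omit [NeZero d] in
/-- `jacobianRatio > 0`. [folklore] -/
theorem jacobianRatio_pos [NeZero d] (k : ℕ) : 0 < jacobianRatio k d := by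
  unfold jacobianRatio
  exact div_pos (ENNReal.toReal_pos (measure_ball_pos volume _ one_pos).ne' measure_ball_lt_top.ne)
    (ENNReal.toReal_pos (measure_ball_pos volume _ one_pos).ne' measure_ball_lt_top.ne)

/-- `qsCLow > 0`. [folklore] -/
theorem qsCLow_pos (k : ℕ) : 0 < qsCLow k d := by
  unfold qsCLow
  have : (0 : ℝ) < d := Nat.cast_pos.2 (NeZero.pos d)
  exact mul_pos (by positivity) (jacobianRatio_pos k)

/-- **The Jacobian constant of the explicit skeleton data lies between `qsCLow` and `qsCUp x`.** [folklore] -/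
theorem jacobian_qs_bounds {x : Fin (k + 2) → EuclideanSpace ℝ (Fin d)} (hx : x ∈ orderedRegion k d) {c : ℝ}
    (hc : ∀ Φ : (Fin (k + 2) → EuclideanSpace ℝ (Fin d)) → ℂ,
      ∫ U, Φ (posAff (qsXi x) (qsFrame x) (linearIndependent_qsFrame hx) U) = (c : ℂ) * ∫ y, Φ y) :
    qsCLow k d ≤ c ∧ c ≤ qsCUp x := by
  constructor
  · have h := jacobian_ge' (qsXi x) (qsFrame x) (linearIndependent_qsFrame hx) hc
    rwa [sum_norm_qsFrame hx] at h
  · refine (jacobian_le (qsXi x) (qsFrame x) (linearIndependent_qsFrame hx) hc).trans ?_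
    unfold qsCUp
    refine mul_le_mul_of_nonneg_right (pow_le_pow_left₀ (norm_nonneg _) ?_ _) (jacobianRatio_pos k).le
    refine ContinuousLinearMap.opNorm_le_bound _ (by have := qsDd_nonneg hx; positivity) fun y => ?_
    exact norm_posLinCLE_symm_le (qsFrame x) (linearIndependent_qsFrame hx) (norm_dualDir_qsFrame_le hx) y

/-! ### The scalar and the profile product of the base index -/

/-- **The scalar bound** `(qsCLow · vol(B̄(0, r₀/2))^{k+2})⁻¹`. [folklore] -/
def qsA0B (x : Fin (k + 2) → EuclideanSpace ℝ (Fin d)) : ℝ :=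
  (qsCLow k d * ((volume (Metric.closedBall (0 : EuclideanSpace ℝ (Fin d)) (qsR0 x / 2))).toReal) ^ (k + 2))⁻¹

/-- **The scalar of the base index is at most `qsA0B`.** [folklore] -/
theorem norm_baseIdx_fst_le_qsA0B {x : Fin (k + 2) → EuclideanSpace ℝ (Fin d)} (hx : x ∈ orderedRegion k d) {c : ℝ}
    (hc0 : 0 < c)
    (hc : ∀ Φ : (Fin (k + 2) → EuclideanSpace ℝ (Fin d)) → ℂ,
      ∫ U, Φ (posAff (qsXi x) (qsFrame x) (linearIndependent_qsFrame hx) U) = (c : ℂ) * ∫ y, Φ y) :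
    ‖(baseIdx (qsFrame x) (linearIndependent_qsFrame hx) k (qsR0_pos hx)).1.1‖ ≤ qsA0B x := by
  refine (norm_baseIdx_fst_le (qsXi x) (qsFrame x) (linearIndependent_qsFrame hx) (qsR0_pos hx) hc0 hc).trans ?_
  unfold qsA0B
  have hv0 : 0 < (volume (Metric.closedBall (0 : EuclideanSpace ℝ (Fin d)) (qsR0 x / 2))).toReal :=
    ENNReal.toReal_pos (Metric.measure_closedBall_pos volume _ (by have := qsR0_pos hx; positivity)).ne'
      measure_closedBall_lt_top.ne
  refine (inv_le_inv₀ (by positivity) (mul_pos (qsCLow_pos k) (by positivity))).2 ?_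
  exact mul_le_mul_of_nonneg_right (jacobian_qs_bounds hx hc).1 (by positivity)

/-- **The profile bound** `(r₀^{-M} |χ₁|_M)^{k+2}`. [folklore] -/
def qsPB (M : ℕ) (x : Fin (k + 2) → EuclideanSpace ℝ (Fin d)) : ℝ :=
  ((qsR0 x ^ M)⁻¹ * schwartzNorm M (rawBumpS (V := EuclideanSpace ℝ (Fin d)) one_pos)) ^ (k + 2)

/-- **The profile product of the base index is at most `qsPB`.** [folklore] -/
theorem profProd_baseIdx_le_qsPB {x : Fin (k + 2) → EuclideanSpace ℝ (Fin d)} (hx : x ∈ orderedRegion k d) (M : ℕ) :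
    profProd M (baseIdx (qsFrame x) (linearIndependent_qsFrame hx) k (qsR0_pos hx)).1.2 ≤ qsPB M x :=
  profProd_baseIdx_le (qsFrame x) (linearIndependent_qsFrame hx) (qsR0_pos hx) (qsR0_le_one x) M

/-! ### The `a`-independent factor of the constants -/

/-- **The sector factor** `exp(2 |b| (K+1) (Λ + π/4)²)`. [folklore] -/
def qsE (x : Fin (k + 2) → EuclideanSpace ℝ (Fin d)) : ℝ :=
  Real.exp (2 * |qsB x| * (slotK k d + 1) * (qsLam x + π / 4) ^ 2)

/-- **The slot factor** `unitSlotBmaxW` at the explicit data. [folklore] -/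
def qsU (Cv : ℕ → ℝ) (M : ℕ) (x : Fin (k + 2) → EuclideanSpace ℝ (Fin d)) : ℝ :=
  unitSlotBmaxW (qsXi x) (qsFrame x) (qsG x) (qsB x) Cv M

/-- **The tube factor** `unitTubeConstW b K (π/4)` at the explicit window. [folklore] -/
def qsTT (k d : ℕ) [NeZero d] (x : Fin (k + 2) → EuclideanSpace ℝ (Fin d)) : ℝ := unitTubeConstW (qsB x) (slotK k d) (π / 4)

/-- **The `a`-independent factor** `qsA = qsE · qsU · qsTT`. [folklore] -/
def qsA (Cv : ℕ → ℝ) (M : ℕ) (x : Fin (k + 2) → EuclideanSpace ℝ (Fin d)) : ℝ := qsE x * qsU Cv M x * qsTT k d x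

/-- `qsA ≥ 0`. [folklore] -/
theorem qsA_nonneg {Cv : ℕ → ℝ} (hCv : ∀ n, 0 ≤ Cv n) (M : ℕ) (x : Fin (k + 2) → EuclideanSpace ℝ (Fin d)) : 0 ≤ qsA Cv M x :=
  mul_nonneg (mul_nonneg (Real.exp_pos _).le (unitSlotBmaxW_nonneg _ _ _ hCv M)) (unitTubeConstW_nonneg _ _ _)

/-- **The constants `regCW` at the explicit data factor through `qsA`.** [folklore] -/
theorem regCW_qs_eq {x : Fin (k + 2) → EuclideanSpace ℝ (Fin d)} (hli : LinearIndependent ℝ (qsFrame x)) (Cv : ℕ → ℝ) (M : ℕ)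
    (a : ℂ × (Fin (k + 2) → 𝓢(EuclideanSpace ℝ (Fin d), ℂ))) :
    regCW (qsXi x) (qsFrame x) (qsG x) (qsB x) Cv M (qsU0 x hli) (qsR x) a = qsA Cv M x * ‖a.1‖ * profProd M a.2 := by
  unfold regCW qsA qsE qsU qsTT
  rw [logRadius_tailR_qsU0 x hli]
  ring

/-! ### The explicit pointwise bound -/

/-- **The explicit bound** `qsF = qsCUp · descBound k d qsD qsA qsA0B qsPB ((d+M)(k+2)) qsR`. [folklore] -/
def qsF (Cv : ℕ → ℝ) (M : ℕ) (x : Fin (k + 2) → EuclideanSpace ℝ (Fin d)) : ℝ :=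
  qsCUp x * descBound k d (qsD M x) (qsA Cv M x) (qsA0B x) (qsPB M x) ((d + M) * (k + 2)) (qsR x)

omit [NeZero d] in
/-- `descBound` is monotone in the scalar and the profile arguments. [folklore] -/
theorem descBound_mono_cP (k d : ℕ) {D A c c' P P' : ℝ} (hD : 0 ≤ D) (hA : 0 ≤ A) (hc : 0 ≤ c) (hcc : c ≤ c') (hP : 0 ≤ P)
    (hPP : P ≤ P') (p : ℕ) {r : ℝ} (hr : 0 ≤ r) : descBound k d D A c P p r ≤ descBound k d D A c' P' p r := by
  unfold descBound
  have hS : 0 ≤ ∑ n ∈ Finset.range (p + 1), ((k + 2 : ℝ) * d) ^ n * 2 ^ n * D ^ n * (2 * (p + 2) / r) ^ n / (n.factorial : ℝ) +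
      ((k + 2 : ℝ) * d) ^ (p + 1) * 2 ^ (p + 1) * D ^ (p + 1) * (2 * (p + 2) / r) ^ (p + 1) / (p.factorial : ℝ) := by
    positivity
  have h1 : A * c * P ≤ A * c' * P' := mul_le_mul (mul_le_mul_of_nonneg_left hcc hA) hPP hP (mul_nonneg hA (hc.trans hcc))
  exact mul_le_mul_of_nonneg_right h1 hS

variable (𝔖 : SchwingerFamily (EuclideanSpace ℝ (Fin d))) (hE1 : 𝔖.IsEuclideanCovariant)
  (hE2 : 𝔖.IsOSReflectionPositive)
  {s : ℕ} {Cv : ℕ → ℝ} (hCv : ∀ n, 0 ≤ Cv n)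
  (hv : ∀ (n : ℕ) (K : 𝓢((Fin n → EuclideanSpace ℝ (Fin d)), ℂ)) (hK : IsPositiveTimeMulti K),
    ‖ι 𝔖 hE2 (δ 𝔖 hE2 (mkGen K hK))‖ ≤ Cv n * schwartzNorm ((n + n) * s) K)
  {M : ℕ} (hM : (k + 1 + (k + 1)) * s ≤ M)
  {s₀ : ℕ} {C₀ : ℝ} (hC₀ : 0 ≤ C₀)
  (hσ : ∀ F : 𝓢((Fin (k + 2) → EuclideanSpace ℝ (Fin d)), ℂ), ‖𝔖 (k + 2) F‖ ≤ C₀ * schwartzNorm s₀ F)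

include hE1 hCv hv hM hC₀ hσ

/-- **The explicit pointwise bound of the Schwinger density** (Osterwalder–Schrader II, Thm. 4.1,
towards (4.5)): for `x` in the ordered region there are `ρ > 0` and `S` holomorphic and bounded on
the complex ball about `x` representing `𝔖_{k+2}` near `x`, with `‖S(x)‖ ≤ qsF Cv M x`. [cite: OsterwalderSchraderCMP1975, Thm. 4.1 (4.5); Ch. V.1; Ch. VI.1] -/
theorem schwinger_density_centre_le (x : Fin (k + 2) → EuclideanSpace ℝ (Fin d)) (hx : x ∈ orderedRegion k d) :
    ∃ ρ : ℝ, 0 < ρ ∧ ∃ S : (Fin (k + 2) → Fin d → ℂ) → ℂ,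
      DifferentiableOn ℂ S (ball (cfgPt x) ρ) ∧ (∃ B : ℝ, ∀ ζ ∈ ball (cfgPt x) ρ, ‖S ζ‖ ≤ B) ∧
      (∀ F : 𝓢((Fin (k + 2) → EuclideanSpace ℝ (Fin d)), ℂ),
        tsupport (F : (Fin (k + 2) → EuclideanSpace ℝ (Fin d)) → ℂ) ⊆ Metric.ball x ρ →
          𝔖 (k + 2) F = ∫ y, S (cfgPt y) * F y) ∧
      ‖S (cfgPt x)‖ ≤ qsF Cv M x := by
  obtain ⟨c, hc, hcv, ρ, hρ, S, hS, hB, hrep, hcentre⟩ := schwinger_exists_holomorphic_density_near_explicit 𝔖 hE1 hE2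
    hCv hv hM hC₀ hσ (qsB_pos x) x hx (qsR0_pos hx) (two_mul_qsR0_lt hx)
  refine ⟨ρ, hρ, S, hS, hB, hrep, hcentre.trans ?_⟩
  have hli : LinearIndependent ℝ (qsFrame x) := linearIndependent_qsFrame hx
  have hdec := deconvBound_admSplit_le (qsFrame x) (linearIndependent_qsFrame hx) M (one_le_qsD M x)
    (fun ν φ hφ => qsD_spec hx M ν φ hφ)
    (C := fun a : AdmIdx k d (qsR0 x) => regCW (qsXi x) (qsFrame x) (qsG x) (qsB x) Cv M
      (qsU0 x (linearIndependent_qsFrame hx)) (qsR x) a.1)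
    (qsA_nonneg hCv M x) (fun a => (regCW_qs_eq (linearIndependent_qsFrame hx) Cv M a.1).le)
    (baseIdx (qsFrame x) (linearIndependent_qsFrame hx) k (qsR0_pos hx)) ((d + M) * (k + 2)) (qsR_pos hx)
  have hcJ := jacobian_qs_bounds hx hcv
  have hA0 := qsA_nonneg hCv M x
  have hD0 : 0 ≤ qsD M x := zero_le_one.trans (one_le_qsD M x)
  have hP0 := profProd_nonneg M (baseIdx (qsFrame x) (linearIndependent_qsFrame hx) k (qsR0_pos hx)).1.2
  have hr0 := qsR_pos hx
  have hn0 := norm_nonneg (baseIdx (qsFrame x) (linearIndependent_qsFrame hx) k (qsR0_pos hx)).1.1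
  have hmid : 0 ≤ descBound k d (qsD M x) (qsA Cv M x) ‖(baseIdx (qsFrame x) (linearIndependent_qsFrame hx) k (qsR0_pos hx)).1.1‖
      (profProd M (baseIdx (qsFrame x) (linearIndependent_qsFrame hx) k (qsR0_pos hx)).1.2) ((d + M) * (k + 2)) (qsR x) := by
    unfold descBound; positivity
  have hCUp0 : 0 ≤ qsCUp x := by
    unfold qsCUp
    have := qsDd_nonneg hx
    have := (jacobianRatio_pos (d := d) k).le
    positivity
  have hmono := descBound_mono_cP k d hD0 hA0 hn0 (norm_baseIdx_fst_le_qsA0B hx hc hcv) hP0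
    (profProd_baseIdx_le_qsPB hx M) ((d + M) * (k + 2)) hr0.le
  unfold qsF
  exact le_trans (mul_le_mul_of_nonneg_left hdec hc.le) (mul_le_mul hcJ.2 hmono hmid hCUp0)

end Literature.MathematicalPhysics.QuantumFieldTheory
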